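import Literature.Probability.Percolation.InequalitiesProofs

/-!
# Reimer's inequality in Harris form, with an explicit deficit (lead c3, crux `IKMixedBoxCrossing`,
# stmt-CriticalPhenomena-5911, line `defect-closure-exploration`, programme (R) of
# `Cruxes/IKMixedBoxCrossing/Lines/defect-closure-exploration-c3.md`)

On a finite weighted cube `{0,1}^α` with a product PROBABILITY weight `W(x) = ∏ᵢ wᵢ(xᵢ)` (`wᵢ ≥ 0`,
`∑ₓ W(x) = 1`) and ARBITRARY events `A, B`, the tree's Reimer inequality
(`Literature.Probability.Percolation.reimer_weighted_cube`: `W(Γ) W(A □ B) ≤ W(A) W(B)`) applied to `A` and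
`Bᶜ` gives the Harris-type LOWER bound
`W(A ∩ B) ≥ W(A) W(B) − W((A ∩ Bᶜ) ∖ (A □ Bᶜ))`:
positive correlation holds up to the mass of the configurations in `A ∩ Bᶜ` that admit NO pair of disjoint
certificates (one forcing `A`, one forcing `Bᶜ`). For increasing `A`, `B` on the cube this deficit is `0`
(Harris); for the IK colour field written on its pivot product space (memo §1 (L1)) the deficit is carried by
the "entangled" configurations (a black witness of `A` cone-adjacent to a white witness of `Bᶜ` at a defect).
No percolation enters this file: it is the abstract inequality, stated with the literal `□` of
`reimer_weighted_cube`.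
-/

namespace Summit.CriticalPhenomena.CardyFormulaZ2.Cruxes.IKMixedBoxCrossing.DefectClosureExploration

open Finset

variable {α : Type*}

/-- Disjoint certification implies occurrence of both events (take `z = x` in both clauses). -/
theorem cubeDisjOcc_subset_inter (A B : Set (α → Bool)) :
    {x : α → Bool | ∃ K : Finset α, (∀ z : α → Bool, (∀ i ∈ K, z i = x i) → z ∈ A) ∧
      (∀ z : α → Bool, (∀ i, i ∉ K → z i = x i) → z ∈ B)} ⊆ A ∩ B := by
  rintro x ⟨K, hA, hB⟩
  exact ⟨hA x fun _ _ => rfl, hB x fun _ _ => rfl⟩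

/-- **Registered stub `stub_reimerHarrisDeficit`** (REIMER'S INEQUALITY, HARRIS FORM WITH DEFICIT). On the
finite cube `{0,1}^α` with a product probability weight `W(x) = ∏ᵢ wᵢ(xᵢ)` (`wᵢ ≥ 0`, total mass `1`) and
arbitrary `A, B ⊆ {0,1}^α`:
`W(A)·W(B) − W((A ∩ Bᶜ) ∖ (A □ Bᶜ)) ≤ W(A ∩ B)`, where
`A □ Bᶜ = {x | ∃ K, [x]_K ⊆ A ∧ [x]_{Kᶜ} ⊆ Bᶜ}` is disjoint certification as in
`Literature.Probability.Percolation.reimer_weighted_cube` (Reimer, *Combin. Probab. Comput.* 9 (2000); Grimmett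
1999, Thm. 2.19). Proof: `W(A ∩ Bᶜ) = W(A □ Bᶜ) + W(deficit set) ≤ W(A) W(Bᶜ) + W(deficit set)` and
`W(Bᶜ) = 1 − W(B)`, `W(A ∩ B) = W(A) − W(A ∩ Bᶜ)`. -/
theorem stub_reimerHarrisDeficit : ∀ {α : Type*} [Fintype α] [DecidableEq α] (w : α → Bool → ℝ),
    (∀ i b, 0 ≤ w i b) → (∑ x : α → Bool, ∏ i, w i (x i) = 1) → ∀ (A B : Set (α → Bool)),
    (∑ x, A.indicator (fun x : α → Bool => ∏ i, w i (x i)) x) *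
        (∑ x, B.indicator (fun x : α → Bool => ∏ i, w i (x i)) x) -
      ∑ x, ((A ∩ Bᶜ) \ {x : α → Bool | ∃ K : Finset α, (∀ z : α → Bool, (∀ i ∈ K, z i = x i) → z ∈ A) ∧
          (∀ z : α → Bool, (∀ i, i ∉ K → z i = x i) → z ∈ Bᶜ)}).indicator
        (fun x : α → Bool => ∏ i, w i (x i)) x ≤
      ∑ x, (A ∩ B).indicator (fun x : α → Bool => ∏ i, w i (x i)) x := by
  intro α _ _ w hw h1 A B
  classical
  set W : (α → Bool) → ℝ := fun x => ∏ i, w i (x i) with hW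
  set D : Set (α → Bool) := {x : α → Bool | ∃ K : Finset α, (∀ z : α → Bool, (∀ i ∈ K, z i = x i) → z ∈ A) ∧
      (∀ z : α → Bool, (∀ i, i ∉ K → z i = x i) → z ∈ Bᶜ)} with hD
  have hWnn : ∀ x, 0 ≤ W x := fun x => Finset.prod_nonneg fun i _ => hw i (x i)
  -- Reimer for `A` and `Bᶜ`, total mass 1
  have hR : ∑ x, D.indicator W x ≤ (∑ x, A.indicator W x) * ∑ x, Bᶜ.indicator W x := by
    have := Literature.Probability.Percolation.reimer_weighted_cube w hw A Bᶜ
    rw [h1, one_mul] at this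
    exact this
  -- additivity of indicator sums over disjoint unions / set differences
  have hsplitB : ∑ x, Bᶜ.indicator W x = 1 - ∑ x, B.indicator W x := by
    have : ∀ x, Bᶜ.indicator W x = W x - B.indicator W x := fun x => by
      by_cases hx : x ∈ B
      · simp [Set.indicator_of_mem hx, Set.indicator_of_notMem (show x ∉ Bᶜ from fun h => h hx)]
      · simp [Set.indicator_of_notMem hx, Set.indicator_of_mem (show x ∈ Bᶜ from hx)]
    simp only [this, Finset.sum_sub_distrib, h1]
  have hsplitA : ∑ x, (A ∩ B).indicator W x = ∑ x, A.indicator W x - ∑ x, (A ∩ Bᶜ).indicator W x := by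
    have : ∀ x, (A ∩ B).indicator W x = A.indicator W x - (A ∩ Bᶜ).indicator W x := fun x => by
      by_cases hxA : x ∈ A
      · by_cases hxB : x ∈ B
        · simp [Set.indicator_of_mem hxA, Set.indicator_of_mem (show x ∈ A ∩ B from ⟨hxA, hxB⟩),
            Set.indicator_of_notMem (show x ∉ A ∩ Bᶜ from fun h => h.2 hxB)]
        · simp [Set.indicator_of_mem hxA, Set.indicator_of_notMem (show x ∉ A ∩ B from fun h => hxB h.2),
            Set.indicator_of_mem (show x ∈ A ∩ Bᶜ from ⟨hxA, hxB⟩)]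
      · simp [Set.indicator_of_notMem hxA, Set.indicator_of_notMem (show x ∉ A ∩ B from fun h => hxA h.1),
          Set.indicator_of_notMem (show x ∉ A ∩ Bᶜ from fun h => hxA h.1)]
    simp only [this, Finset.sum_sub_distrib]
  have hDsub : D ⊆ A ∩ Bᶜ := cubeDisjOcc_subset_inter A Bᶜ
  have hsplitD : ∑ x, (A ∩ Bᶜ).indicator W x = ∑ x, D.indicator W x + ∑ x, ((A ∩ Bᶜ) \ D).indicator W x := by
    have : ∀ x, (A ∩ Bᶜ).indicator W x = D.indicator W x + ((A ∩ Bᶜ) \ D).indicator W x := fun x => by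
      by_cases hxD : x ∈ D
      · simp [Set.indicator_of_mem hxD, Set.indicator_of_mem (hDsub hxD),
          Set.indicator_of_notMem (show x ∉ (A ∩ Bᶜ) \ D from fun h => h.2 hxD)]
      · by_cases hx : x ∈ A ∩ Bᶜ
        · simp [Set.indicator_of_notMem hxD, Set.indicator_of_mem hx,
            Set.indicator_of_mem (show x ∈ (A ∩ Bᶜ) \ D from ⟨hx, hxD⟩)]
        · simp [Set.indicator_of_notMem hxD, Set.indicator_of_notMem hx,
            Set.indicator_of_notMem (show x ∉ (A ∩ Bᶜ) \ D from fun h => hx h.1)]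
    simp only [this, Finset.sum_add_distrib]
  -- mass of `A` is at most 1
  have hA1 : ∑ x, A.indicator W x ≤ 1 := by
    rw [← h1]
    exact Finset.sum_le_sum fun x _ => Set.indicator_le_self' (fun _ _ => hWnn x) x
  have hAnn : 0 ≤ ∑ x, A.indicator W x := Finset.sum_nonneg fun x _ => Set.indicator_nonneg (fun _ _ => hWnn x) x
  have hBc : ∑ x, Bᶜ.indicator W x = 1 - ∑ x, B.indicator W x := hsplitB
  have hkey : ∑ x, D.indicator W x ≤ (∑ x, A.indicator W x) * (1 - ∑ x, B.indicator W x) := by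
    rw [← hBc]; exact hR
  rw [hsplitA, hsplitD]
  nlinarith [hkey, hAnn, hA1]

end Summit.CriticalPhenomena.CardyFormulaZ2.Cruxes.IKMixedBoxCrossing.DefectClosureExploration
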